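import Summits.QuantumFields.YangMills.Theorems.BalabanUVNodesN07IterPlaquettesOfFineBoxPlaquettes
import Summits.QuantumFields.YangMills.Theorems.BalabanUVNodesN07Lemma1CrossingBondsTwoBlocks
import Literature.MathematicalPhysics.QuantumFieldTheory.Balaban1983to89.B8Eq131CubesRec
import Literature.MathematicalPhysics.QuantumFieldTheory.Balaban1983to89.B8Eq17ClassAkV1
import HarnessLib

/-!
# N07 [B11] (= [15] = [Balaban1985Variational]) Sect. F ∕ [I] (0.4) — MODULE 137: **THE (0.4) GUARD ON THE WINDOW BONDS OF A CENTRED CUBE TOWER FROM ONE FINE PLAQUETTE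
# LETTER** — the `hs` binder of g12 `…N07TowerGaugeCoverLiftWindow.localGaugeZ_coverLiftShift_eq_of_mem_tcubeZ` DISCHARGED: for a cube datum `(a, M, ρ)` of level `k` whose
# blow-up `□̃` is covered by the fine letter (`π '' □̃ ⊆ Ω_c`, `PlaqSmallOn (plaqsOf Ω_c) a₀ U`), every window bond `(q, q + e_κ)` at depth `k − (i+1)` (`i < k`) has
# `BlockAveraging.Small ℰ_N (M^i U) ⟨π_{i+1}(q + c_{k−i−1}·𝟙), κ⟩` under three displayed per-level smallness rows of `a₀`

Cell `pub-ymgap`, seat `pub-ymgap-dag-n07-e` g33 (FAN-OUT §N07 row s3; LANE OWNER of the K0 road chart side; ASK-6 of the φ-junction dag-n07-w3 g13∕g14, director-ym №330).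
`--kind proof --supports stmt-QuantumFields-20541 --as helper` (K0⁷; count-neutral).  THEOREMS ONLY (0 `def`); generic `P`, `SU(N)`.  [15] = [Balaban1985Variational];
[6] = [Balaban1985RegularSpaces]; [3] = [Balaban1985Averaging]; [I] = [Balaban1987RG1].

WHY.  The junction's per-cell row 9′ (dag-n07-w3 ✓p760822 `torusRow_at_recordCube_cell`) takes `hvfix : c.vfix V x = ιSU(g₂(π(x + c_k·𝟙)))` on `Ω′₀`: the R7 door's clamped
tower gauge `vfix = localGaugeZ …` IS the lift of an honest torus gauge `g₂` whose averages `M^n(U^{g₂})` are radially axial (`hax₂`).  g12's §5 (✓`localGaugeZ_coverLiftShift_eq_of_mem_tcubeZ`)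
supplies exactly this identity from a residual radial tower `w` (in tree: ✓`…N07AxialTowerRepresentative.exists_residual_axialTower`) — MODULO its displayed guard `hs`: every
intermediate average `M^i U`, `i < k`, is inside the (0.4) guard `Small ℰ_N` at every coarse bond of the depth-`(k − (i+1))` window.  THIS FILE discharges `hs` from the fine letter on
`□̃`: the loop variables of (0.4) at a coarse bond `c = ⟨castSite q, κ⟩` read only the TWO blocks `B(q) ∪ B(q + e_κ)` (MODULE 70 ✓`…N07Lemma1CrossingBondsTwoBlocks.small_of_twoBlocks`;
the three-block supplier `BlockAveragingPlaquetteBoundLocal.small_of_plaqSmallOn_blocks` would leave `□̃` at the window's boundary), the level-`i` plaquettes of `M^i U` on that two-block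
box come from the fine plaquettes on the fine two-block box under it (the TWO-BLOCK edition of MODULE 127 ✓`…N07IterPlaquettesOfFineBoxPlaquettes`: pv26's box gauge on the
`2L^{i+1} × L^{i+1} × ⋯` fine box + this lineage's local dictionary `emlIterU_unitsField_eq_iter_of_reads_set` at `T := {castSite q, castSite (q + e_κ)}`, `s₂ := (d−1)(2L^{i+1}−1)·a₀`),
and the fine two-block box under a CENTRED window bond lies in the UNCENTRED `tcube` exactly (`2·c_n + 1 = Lⁿ`), where the collar `π '' □̃ ⊆ Ω_c` places the fine letter.

WHAT IS PROVED (sorry-free; axioms standard).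
§1 geometry of the fine two-block box `[Lʲq, Lʲ(q + e_κ) + Lʲ − 1]` (`fineBox_subset_twoBlockBox_left∕_right`, `twoBlockBox_side`, `succ_succ_le_of_two_mul_L_lt`,
   `twoBlockBox_nonwrapping`, `blockOf_castSite_mem_pair_of_mem_twoBlockBox`).
§2 ★★ `exists_boxGauge_dist1_iter_bond_le_of_fineTwoBlockPlaqs` (MODULE 127 §2 at `T := {castSite q, castSite (q + e_κ)}`), ★★ `dist1_plaqHol_iter_le_of_fineTwoBlockPlaqs`
   (every level-`n` plaquette of the two-block box of `M^n U` within `120ℓLⁿs₂`), ★★ `small_iter_of_fineTwoBlockPlaqs` (∘ MODULE 70: `Small ℰ_N (M^n U) ⟨castSite q, κ⟩`).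
§3 `twoBlockBox_subset_tcube_of_window` (centred window bond ⇒ fine two-block box `⊆ tcube`), `boxPlaqs_twoBlock_subset_plaqsOf_of_collar`.
§4 ★★★ `windowSmall_of_fineLetter` — g12's `hs` VERBATIM from `PlaqSmallOn (plaqsOf Ω_c) a₀ U` (`0 < a₀`, `2 ≤ d`), `π '' tcube ⊆ Ω_c`, `2L < sitesPerDir i` and three per-level rows:
   `6400ℓ²L^{i+1}s₂ ≤ 1`, `30ℓ²L^{i+1}s₂ < δ_N`, `(ℓ²∕4)·((4(d−1)(2L−1)+1)·(240ℓLⁱs₂)) < δ_N` (`ℓ = (d+2)L`, `s₂ = (d−1)(2L^{i+1}−1)a₀`); `two_mul_L_lt_sitesPerDir_of_lt`.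
HONEST SCOPE: elementary composition of landed bookkeeping (MODULES 70, 127; pv26's axial gauge; the local dictionary); crude constants; nothing of [15]∕[6]∕[3]∕[I] analysis asserted
beyond the cited modules; `hJ` ∕ `DatumCrownPhiAt` ∕ `hsup` ∕ HSEAM inhabited by nobody; `HThm4RecSym152PhiEG` ∕ `HThm4Rec*` UNDISCHARGED; N07 NOT discharged; K0⁷ NOT closed; counts
unmoved (typed 28∕28 · discharged 8∕28); one finite 𝕋⁴ programme at fixed ε — the route closes the conditional finite-𝕋⁴ rung `BalabanLadder.UV` ONLY; the YM mass gap (Clay) is NOT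
proved by any of this; nothing continuum ∕ ℝ⁴ ∕ OS.  No `def`, no `instance`, no `notation`, no `sorry`.

References: [I] (0.1) p. 251, (0.3)–(0.4) pp. 252–253; [6] (1.14)–(1.15) p. 78, Lemma 1 p. 79, p. 98; [3] Prop. 4 p. 38; [15] (17) p. 280, (144) p. 300, (146)–(147) p. 301.
-/

set_option autoImplicit false

noncomputable section

open scoped BigOperators Matrix.Norms.L2Operator

namespace Summit.QuantumFields.YangMills.BalabanUVNodes.N07WindowGuardOfFineLetter

open Literature.MathematicalPhysics.QuantumFieldTheory.Balaban1983to89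
open Literature.MathematicalPhysics.QuantumFieldTheory.Balaban1983to89.Node00
open T4Continuum (transfUp iter_gaugeAct)
open T4AxialGaugeSmallField (castSite castSite_apply castSite_add_e boxBonds boxPlaqs axialGauge dist1_gaugeAct_axialGauge_le_of_mem_boxBonds)
open B7Prop1Explicit (e e_apply)
open B7Prop1Local (InBox)
open B14DomainGeom (Pt)
open B5Eq118OneStroke (iterBlockOf iterBlockOf_succ iterBlockOf_zero)
open GaugeField (gaugeAct)
open ExpMeanLog (expMeanLogSU deltaSU)
open FederbushMean (dist1_SU_eq)
open BlockAveraging (blockAvg Small)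
open BlockAveragingZd (ctrShift two_mul_ctrShift_add_one)
open B15Eq112TorusCover (cover)
open B8Eq17ClassAkV1 (plaqsOf mem_plaqsOf)
open B8Eq131Cubes (tcube tLo tHi)
open Summit.QuantumFields.YangMills.BalabanUVNodes.N07DbarFrameTowerOfReads (emlIterU_unitsField_eq_iter_of_reads_set)
open Summit.QuantumFields.YangMills.BalabanUVNodes.N07ShearSizeTopBox (mem_boxBonds_of_ends_mem_box)
open Summit.QuantumFields.YangMills.BalabanUVNodes.N07IterPlaquettesOfFineBoxPlaquettes (mem_fineBox_of_iterBlockOf_eq blockOf_castSite_of_mem_box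
  iterBlockOf_succ_eq_of_iterBlockOf_eq)
open Summit.QuantumFields.YangMills.BalabanUVNodes.N07Lemma1CrossingBondsTwoBlocks (small_of_twoBlocks)
open Summit.QuantumFields.YangMills.Theorems.IterPlaqSmallAllL (dist1_plaqHol_gaugeAct)

variable {P : Params} {N : ℕ} [NeZero N]

/-! ## §1  Geometry of the fine two-block box `[Lʲq, Lʲ(q + e_κ) + Lʲ − 1]` -/

/-- The fine box under the block `q` lies in the fine two-block box under `(q, q + e_κ)`. [cite: Balaban1987RG1, (0.1)–(0.3) pp.251–252 (bookkeeping)] -/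
theorem fineBox_subset_twoBlockBox_left (j : ℕ) (q : Pt P.d) (κ : Fin P.d) :
    Set.Icc (fun i => (P.L : ℤ) ^ j * q i) (fun i => (P.L : ℤ) ^ j * q i + ((P.L : ℤ) ^ j - 1)) ⊆
      Set.Icc (fun i => (P.L : ℤ) ^ j * q i) (fun i => (P.L : ℤ) ^ j * (q + e κ) i + ((P.L : ℤ) ^ j - 1)) := by
  intro x hx
  refine ⟨hx.1, fun i => ?_⟩
  have h := hx.2 i
  have he : (0 : ℤ) ≤ e κ i := by rw [e_apply]; split_ifs <;> norm_num
  have hL : (0 : ℤ) ≤ (P.L : ℤ) ^ j := by positivity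
  simp only [Pi.add_apply] at h ⊢
  nlinarith

/-- The fine box under the block `q + e_κ` lies in the fine two-block box under `(q, q + e_κ)`. [cite: Balaban1987RG1, (0.1)–(0.3) pp.251–252 (bookkeeping)] -/
theorem fineBox_subset_twoBlockBox_right (j : ℕ) (q : Pt P.d) (κ : Fin P.d) :
    Set.Icc (fun i => (P.L : ℤ) ^ j * (q + e κ) i) (fun i => (P.L : ℤ) ^ j * (q + e κ) i + ((P.L : ℤ) ^ j - 1)) ⊆
      Set.Icc (fun i => (P.L : ℤ) ^ j * q i) (fun i => (P.L : ℤ) ^ j * (q + e κ) i + ((P.L : ℤ) ^ j - 1)) := by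
  intro x hx
  refine ⟨fun i => ?_, hx.2⟩
  have h := hx.1 i
  have he : (0 : ℤ) ≤ e κ i := by rw [e_apply]; split_ifs <;> norm_num
  have hL : (0 : ℤ) ≤ (P.L : ℤ) ^ j := by positivity
  simp only [Pi.add_apply] at h ⊢
  nlinarith

/-- The fine two-block box has at most `2Lʲ` sites per direction. [cite: Balaban1987RG1, (0.1) p.251 (bookkeeping)] -/
theorem twoBlockBox_side (j : ℕ) (q : Pt P.d) (κ : Fin P.d) :
    ∀ i, (fun i => (P.L : ℤ) ^ j * (q + e κ) i + ((P.L : ℤ) ^ j - 1)) i ≤ (fun i => (P.L : ℤ) ^ j * q i) i + ((2 * P.L ^ j - 1 : ℕ) : ℤ) := by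
  intro i
  have he : e κ i ≤ (1 : ℤ) := by rw [e_apply]; split_ifs <;> norm_num
  have h1 : 1 ≤ 2 * P.L ^ j := by have := Nat.one_le_pow j P.L P.L_pos; omega
  have hL : (0 : ℤ) ≤ (P.L : ℤ) ^ j := by positivity
  simp only [Pi.add_apply]
  push_cast [Nat.cast_sub h1]
  nlinarith

/-- `2L < sitesPerDir n` forces two levels of room above `n`: `n + 2 ≤ m + K` (`sitesPerDir n = 2L^{m+K−n}`). [cite: Balaban1987RG1, (0.1) p.251 (bookkeeping)] -/
theorem succ_succ_le_of_two_mul_L_lt {n : ℕ} (hN : 2 * P.L < P.sitesPerDir n) : n + 2 ≤ P.m + P.K := by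
  rw [Params.sitesPerDir] at hN
  by_contra h
  have h1 : P.m + P.K - n ≤ 1 := by omega
  have h2 : P.L ^ (P.m + P.K - n) ≤ P.L ^ 1 := Nat.pow_le_pow_right P.L_pos h1
  rw [pow_one] at h2
  omega

/-- The fine two-block box under a level-`j` bond, `j < m + K`, does not wrap (`2Lʲ < N₀ = 2L^{m+K}`, ym3-torus `Prop7FibreLevelSupLocalGauge.two_mul_pow_lt_sitesPerDir_zero`,
re-derived inline to keep the imports light), in the shape of `mem_boxBonds_of_ends_mem_box`. [cite: Balaban1987RG1, (0.1) p.251 (bookkeeping)] -/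
theorem twoBlockBox_nonwrapping {j : ℕ} (hj : j < P.m + P.K) (q : Pt P.d) (κ : Fin P.d) :
    ∀ i, ((P.L : ℤ) ^ j * (q + e κ) i + ((P.L : ℤ) ^ j - 1)) + 1 - (P.L : ℤ) ^ j * q i < (P.sitesPerDir 0 : ℤ) := by
  intro i
  have h := twoBlockBox_side j q κ i
  have h2 : 2 * P.L ^ j < P.sitesPerDir 0 := by
    have hpow : P.L ^ j < P.L ^ (P.m + P.K) := Nat.pow_lt_pow_right P.hL.2 hj
    rw [Params.sitesPerDir, Nat.sub_zero]
    omega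
  have h1 : 1 ≤ 2 * P.L ^ j := by have := Nat.one_le_pow j P.L P.L_pos; omega
  have h3 : (((2 * P.L ^ j - 1 : ℕ)) : ℤ) + 1 < (P.sitesPerDir 0 : ℤ) := by
    have h4 : (((2 * P.L ^ j : ℕ)) : ℤ) < (P.sitesPerDir 0 : ℤ) := by exact_mod_cast h2
    push_cast [Nat.cast_sub h1] at h4 ⊢
    linarith
  simp only at h
  linarith

/-- A level-`n` site of the two-block box `[L·q, L·(q + e_κ) + L − 1]` has block point `castSite q` or `castSite (q + e_κ)` (standing range). [cite: Balaban1987RG1, (0.1)–(0.3) pp.251–252 (bookkeeping)] -/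
theorem blockOf_castSite_mem_pair_of_mem_twoBlockBox {n : ℕ} (hn : n + 1 ≤ P.m + P.K) (q : Pt P.d) (κ : Fin P.d) {w : Pt P.d}
    (hlo : (fun i => (P.L : ℤ) * q i) ≤ w) (hhi : w ≤ fun i => (P.L : ℤ) * (q + e κ) i + ((P.L : ℤ) - 1)) :
    blockOf (castSite w : Site P n) ∈ ({castSite q, castSite (q + e κ)} : Set (Site P (n + 1))) := by
  by_cases hc : w κ ≤ (P.L : ℤ) * q κ + ((P.L : ℤ) - 1)
  · refine Set.mem_insert_iff.2 (Or.inl (blockOf_castSite_of_mem_box hn q hlo (fun i => ?_)))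
    by_cases hi : i = κ
    · subst hi; exact hc
    · have h := hhi i
      simp only [Pi.add_apply, e_apply, if_neg hi, add_zero] at h
      exact h
  · refine Set.mem_insert_iff.2 (Or.inr (Set.mem_singleton_iff.2 (blockOf_castSite_of_mem_box hn (q + e κ) (fun i => ?_) hhi)))
    by_cases hi : i = κ
    · subst hi
      have hc' := not_le.1 hc
      have hk : ∀ j : Fin P.d, e j j = (1 : ℤ) := fun j => by rw [e_apply, if_pos rfl]
      simp only [Pi.add_apply, hk]
      linarith
    · have h := hlo i
      simp only [Pi.add_apply, e_apply, if_neg hi, add_zero]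
      exact h

/-! ## §2  The two-block edition of MODULE 127, and the (0.4) guard at one coarse bond -/

/-- ★★ **IN pv26's BOX GAUGE OF THE FINE TWO-BLOCK BOX UNDER `(q, q + e_κ)`, THE `i`-BONDS OF THE AVERAGES UNDER THE TWO BLOCKS ARE NEAR `1`**, `i ≤ n+1` — MODULE 127 §2 with the
read set `T := {castSite q, castSite (q + e_κ)}` and `s₂ := (d−1)(2L^{n+1}−1)·a₀`: `dist1 (M^i(U^g) b) ≤ 30ℓLⁱ·s₂` for every `i`-bond whose ends lie under the two blocks.
[cite: Balaban1985Averaging, Prop. 4 (134)–(135) p.38, (11) p.19; Balaban1985RegularSpaces, Lemma 1 p.79; Balaban1987RG1, (0.4) p.253] -/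
theorem exists_boxGauge_dist1_iter_bond_le_of_fineTwoBlockPlaqs {n : ℕ} (hn : n + 2 ≤ P.m + P.K) (U : GaugeField P 0 (SU N)) {a₀ : ℝ} (ha₀ : 0 ≤ a₀) (q : Pt P.d) (κ : Fin P.d)
    {S₀ : Set (Plaq P 0)} (hS₀ : boxPlaqs (fun i => (P.L : ℤ) ^ (n + 1) * q i) (fun i => (P.L : ℤ) ^ (n + 1) * (q + e κ) i + ((P.L : ℤ) ^ (n + 1) - 1)) ⊆ S₀)
    (hU : PlaqSmallOn S₀ a₀ U)
    (hbud : 6400 * (((P.d + 2) * P.L : ℕ) : ℝ) ^ 2 * (P.L : ℝ) ^ (n + 1) * ((((P.d - 1 : ℕ) : ℝ)) * (((2 * P.L ^ (n + 1) - 1 : ℕ) : ℝ)) * a₀) ≤ 1)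
    (hgd : 30 * (((P.d + 2) * P.L : ℕ) : ℝ) ^ 2 * (P.L : ℝ) ^ (n + 1) * ((((P.d - 1 : ℕ) : ℝ)) * (((2 * P.L ^ (n + 1) - 1 : ℕ) : ℝ)) * a₀) < deltaSU (Fin N)) :
    ∃ g : GaugeTransf P 0 (SU N), ∀ (i : ℕ), i ≤ n + 1 → ∀ b : PBond P i,
      (∀ x : Site P 0, iterBlockOf i x = b.src → iterBlockOf (n + 1) x ∈ ({castSite q, castSite (q + e κ)} : Set (Site P (n + 1)))) →
      (∀ x : Site P 0, iterBlockOf i x = b.tgt → iterBlockOf (n + 1) x ∈ ({castSite q, castSite (q + e κ)} : Set (Site P (n + 1)))) →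
      dist1 (Averaging.iter (fun _ => blockAvg (expMeanLogSU (n := Fin N))) i (gaugeAct g U) b) ≤
        30 * (((P.d + 2) * P.L : ℕ) : ℝ) * (P.L : ℝ) ^ i * ((((P.d - 1 : ℕ) : ℝ)) * (((2 * P.L ^ (n + 1) - 1 : ℕ) : ℝ)) * a₀) := by
  classical
  set lo : Pt P.d := fun i => (P.L : ℤ) ^ (n + 1) * q i with hlo
  set hi' : Pt P.d := fun i => (P.L : ℤ) ^ (n + 1) * (q + e κ) i + ((P.L : ℤ) ^ (n + 1) - 1) with hhi
  set s₂ : ℝ := (((P.d - 1 : ℕ) : ℝ)) * (((2 * P.L ^ (n + 1) - 1 : ℕ) : ℝ)) * a₀ with hs₂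
  have hs₂0 : 0 ≤ s₂ := by positivity
  -- pv26's box gauge on the fine two-block box
  set g : GaugeTransf P 0 (SU N) := axialGauge U lo hi' with hg
  have hn1 : n + 1 ≤ P.m + P.K := Nat.le_of_succ_le hn
  have hside : ∀ κ', hi' κ' ≤ lo κ' + ((2 * P.L ^ (n + 1) - 1 : ℕ) : ℤ) := twoBlockBox_side (n + 1) q κ
  have hN' := twoBlockBox_nonwrapping (P := P) (j := n + 1) hn q κ
  have hsideN : 2 * P.L ^ (n + 1) - 1 < P.sitesPerDir 0 := by
    have h0 := hN' κ
    have h1 : 1 ≤ 2 * P.L ^ (n + 1) := by have := Nat.one_le_pow (n + 1) P.L P.L_pos; omega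
    have he : e κ κ = (1 : ℤ) := by rw [e_apply, if_pos rfl]
    simp only [Pi.add_apply, he] at h0
    have h2 : (((2 * P.L ^ (n + 1) - 1 : ℕ) : ℤ)) < (P.sitesPerDir 0 : ℤ) := by push_cast [Nat.cast_sub h1]; linarith
    exact_mod_cast h2
  -- the ends of a fine bond under the two blocks lie in the fine two-block box
  have hmem : ∀ x : Site P 0, iterBlockOf (n + 1) x ∈ ({castSite q, castSite (q + e κ)} : Set (Site P (n + 1))) →
      x ∈ (castSite '' Set.Icc lo hi' : Set (Site P 0)) := by
    intro x hx
    rcases hx with h | h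
    · obtain ⟨X, hX, hXx⟩ := mem_fineBox_of_iterBlockOf_eq hn1 q h
      exact ⟨X, fineBox_subset_twoBlockBox_left (n + 1) q κ hX, hXx⟩
    · rw [Set.mem_singleton_iff] at h
      obtain ⟨X, hX, hXx⟩ := mem_fineBox_of_iterBlockOf_eq hn1 (q + e κ) h
      exact ⟨X, fineBox_subset_twoBlockBox_right (n + 1) q κ hX, hXx⟩
  -- reads of `U^g` on the fine bonds under the two blocks
  have hreads : ∀ b₀ : PBond P 0, iterBlockOf (n + 1) b₀.src ∈ ({castSite q, castSite (q + e κ)} : Set (Site P (n + 1))) →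
      iterBlockOf (n + 1) b₀.tgt ∈ ({castSite q, castSite (q + e κ)} : Set (Site P (n + 1))) →
      ‖((gaugeAct g U b₀ : SU N) : Matrix (Fin N) (Fin N) ℂ) - 1‖ ≤ s₂ := by
    intro b₀ hb₀s hb₀t
    rw [← dist1_SU_eq]
    have h := dist1_gaugeAct_axialGauge_le_of_mem_boxBonds U hS₀ hU ha₀ hside hsideN (mem_boxBonds_of_ends_mem_box hN' (hmem _ hb₀s) (hmem _ hb₀t))
    rw [hs₂]
    exact h.trans (le_of_eq (by ring))
  refine ⟨g, fun i hi b hbs hbt => ?_⟩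
  have hdict := emlIterU_unitsField_eq_iter_of_reads_set hn1 ({castSite q, castSite (q + e κ)} : Set (Site P (n + 1))) (gaugeAct g U) hs₂0 hbud hgd hreads i hi b hbs hbt
  rw [dist1_SU_eq]
  exact hdict.2

/-- ★★ **EVERY LEVEL-`n` PLAQUETTE OF `M^nU` BASED IN THE TWO-BLOCK BOX `[L·q, L·(q + e_κ) + L − 1]` IS NEAR `1`**: `dist1 (plaqHol (M^nU) p) ≤ 120ℓLⁿ·s₂` — MODULE 127 §3 with
two blocks: the four corners of `p` have block point `castSite q` or `castSite (q + e_κ)` (§1), each bond is within `30ℓLⁿs₂` in the box gauge (§2), a plaquette is within the sum of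
its four bonds, and the plaquettes of `M^n(U^g) = (M^nU)^{g↑}` are those of `M^nU`. [cite: Balaban1985Variational, (146) p.301, (17) p.280; Balaban1985Averaging, Prop. 4 p.38; Balaban1985RegularSpaces, (1.33)–(1.34) p.82; Balaban1987RG1, (0.4) p.253] -/
theorem dist1_plaqHol_iter_le_of_fineTwoBlockPlaqs {n : ℕ} (hn : n + 2 ≤ P.m + P.K) (U : GaugeField P 0 (SU N)) {a₀ : ℝ} (ha₀ : 0 ≤ a₀) (q : Pt P.d) (κ : Fin P.d)
    {S₀ : Set (Plaq P 0)} (hS₀ : boxPlaqs (fun i => (P.L : ℤ) ^ (n + 1) * q i) (fun i => (P.L : ℤ) ^ (n + 1) * (q + e κ) i + ((P.L : ℤ) ^ (n + 1) - 1)) ⊆ S₀)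
    (hU : PlaqSmallOn S₀ a₀ U)
    (hbud : 6400 * (((P.d + 2) * P.L : ℕ) : ℝ) ^ 2 * (P.L : ℝ) ^ (n + 1) * ((((P.d - 1 : ℕ) : ℝ)) * (((2 * P.L ^ (n + 1) - 1 : ℕ) : ℝ)) * a₀) ≤ 1)
    (hgd : 30 * (((P.d + 2) * P.L : ℕ) : ℝ) ^ 2 * (P.L : ℝ) ^ (n + 1) * ((((P.d - 1 : ℕ) : ℝ)) * (((2 * P.L ^ (n + 1) - 1 : ℕ) : ℝ)) * a₀) < deltaSU (Fin N))
    (p : Plaq P n) (hp : p ∈ boxPlaqs (fun i => (P.L : ℤ) * q i) (fun i => (P.L : ℤ) * (q + e κ) i + ((P.L : ℤ) - 1))) :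
    dist1 (GaugeField.plaqHol (Averaging.iter (fun _ => blockAvg (expMeanLogSU (n := Fin N))) n U) p) ≤
      120 * (((P.d + 2) * P.L : ℕ) : ℝ) * (P.L : ℝ) ^ n * ((((P.d - 1 : ℕ) : ℝ)) * (((2 * P.L ^ (n + 1) - 1 : ℕ) : ℝ)) * a₀) := by
  obtain ⟨g, hg⟩ := exists_boxGauge_dist1_iter_bond_le_of_fineTwoBlockPlaqs hn U ha₀ q κ hS₀ hU hbud hgd
  have hn1 : n + 1 ≤ P.m + P.K := Nat.le_of_succ_le hn
  -- the four corners of `p` have block point in `T`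
  obtain ⟨z, hzlo, hzhi, hsrc⟩ := hp
  have he0 : ∀ (κ' : Fin P.d) (i : Fin P.d), (0 : ℤ) ≤ e κ' i := fun κ' i => by rw [e_apply]; split_ifs <;> norm_num
  have hc1 : blockOf (castSite z : Site P n) ∈ ({castSite q, castSite (q + e κ)} : Set (Site P (n + 1))) :=
    blockOf_castSite_mem_pair_of_mem_twoBlockBox hn1 q κ hzlo
      (fun i => by have h1 := hzhi i; have h2 := he0 p.μ i; have h3 := he0 p.ν i; simp only [Pi.add_apply] at h1 ⊢; linarith)
  have hc2 : blockOf (castSite (z + e p.μ) : Site P n) ∈ ({castSite q, castSite (q + e κ)} : Set (Site P (n + 1))) :=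
    blockOf_castSite_mem_pair_of_mem_twoBlockBox hn1 q κ (fun i => by have h1 := hzlo i; have h2 := he0 p.μ i; simp only [Pi.add_apply] at h1 ⊢; linarith)
      (fun i => by have h1 := hzhi i; have h3 := he0 p.ν i; simp only [Pi.add_apply] at h1 ⊢; linarith)
  have hc3 : blockOf (castSite (z + e p.ν) : Site P n) ∈ ({castSite q, castSite (q + e κ)} : Set (Site P (n + 1))) :=
    blockOf_castSite_mem_pair_of_mem_twoBlockBox hn1 q κ (fun i => by have h1 := hzlo i; have h2 := he0 p.ν i; simp only [Pi.add_apply] at h1 ⊢; linarith)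
      (fun i => by have h1 := hzhi i; have h3 := he0 p.μ i; simp only [Pi.add_apply] at h1 ⊢; linarith)
  have hc4 : blockOf (castSite (z + e p.μ + e p.ν) : Site P n) ∈ ({castSite q, castSite (q + e κ)} : Set (Site P (n + 1))) :=
    blockOf_castSite_mem_pair_of_mem_twoBlockBox hn1 q κ
      (fun i => by have h1 := hzlo i; have h2 := he0 p.μ i; have h3 := he0 p.ν i; simp only [Pi.add_apply] at h1 ⊢; linarith) hzhi
  -- in torus letters
  have hs1 : p.src = castSite z := hsrc
  have hs2 : p.src.shift p.μ = castSite (z + e p.μ) := by rw [castSite_add_e, hs1]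
  have hs3 : p.src.shift p.ν = castSite (z + e p.ν) := by rw [castSite_add_e, hs1]
  have hs4 : (p.src.shift p.μ).shift p.ν = castSite (z + e p.μ + e p.ν) := by rw [castSite_add_e, hs2]
  have hs4' : (p.src.shift p.ν).shift p.μ = castSite (z + e p.μ + e p.ν) := by
    rw [add_right_comm, castSite_add_e, hs3]
  -- the under-the-two-blocks conditions of the four bonds
  have under : ∀ w : Site P n, blockOf w ∈ ({castSite q, castSite (q + e κ)} : Set (Site P (n + 1))) →
      ∀ x : Site P 0, iterBlockOf n x = w → iterBlockOf (n + 1) x ∈ ({castSite q, castSite (q + e κ)} : Set (Site P (n + 1))) := by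
    intro w hw x hx
    rcases hw with h | h
    · exact Set.mem_insert_iff.2 (Or.inl (iterBlockOf_succ_eq_of_iterBlockOf_eq hx h))
    · exact Set.mem_insert_iff.2 (Or.inr (Set.mem_singleton_iff.2 (iterBlockOf_succ_eq_of_iterBlockOf_eq hx (Set.mem_singleton_iff.1 h))))
  have u1 := under _ (hs1 ▸ hc1)
  have u2 := under _ (hs2 ▸ hc2)
  have u3 := under _ (hs3 ▸ hc3)
  have u4 := under _ (hs4 ▸ hc4)
  have u4' := under _ (hs4' ▸ hc4)
  set W := Averaging.iter (fun _ => blockAvg (expMeanLogSU (n := Fin N))) n (gaugeAct g U) with hW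
  have h1 := hg n (Nat.le_succ n) ⟨p.src, p.μ⟩ u1 u2
  have h2 := hg n (Nat.le_succ n) ⟨p.src.shift p.μ, p.ν⟩ u2 u4
  have h3 := hg n (Nat.le_succ n) ⟨p.src.shift p.ν, p.μ⟩ u3 u4'
  have h4 := hg n (Nat.le_succ n) ⟨p.src, p.ν⟩ u1 u3
  -- covariance: the plaquettes of `M^n(U^g)` are those of `M^nU`
  have hcov : W = gaugeAct (transfUp g n) (Averaging.iter (fun _ => blockAvg (expMeanLogSU (n := Fin N))) n U) :=
    iter_gaugeAct _ g n (Nat.le_of_succ_le hn1) U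
  rw [← dist1_plaqHol_gaugeAct (transfUp g n), ← hcov]
  refine (B10Eq6DensityLevel.dist1_plaqHol_le W p).trans ?_
  have hsum := add_le_add (add_le_add (add_le_add h1 h2) h3) h4
  refine hsum.trans (le_of_eq ?_)
  ring

/-- ★★ **THE (0.4) GUARD AT ONE COARSE BOND FROM THE FINE PLAQUETTES UNDER ITS TWO BLOCKS**: for `2 ≤ d`, `n + 1 ≤ m + K`, `2L < sitesPerDir n`, `0 < a₀`, the fine letter on the fine two-block box
under `(q, q + e_κ)` and the three rows `6400ℓ²L^{n+1}s₂ ≤ 1`, `30ℓ²L^{n+1}s₂ < δ_N`, `(ℓ²∕4)·((4(d−1)(2L−1)+1)·(240ℓLⁿs₂)) < δ_N`: `BlockAveraging.Small ℰ_N (M^nU) ⟨castSite q, κ⟩` —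
§2's plaquette letter `240ℓLⁿs₂` on the two-block box fed to MODULE 70 ✓`small_of_twoBlocks`. [cite: Balaban1987RG1, (0.4) p.253; Balaban1985RegularSpaces, Lemma 1 (1.25) p.79; Balaban1985Variational, (146) p.301] -/
theorem small_iter_of_fineTwoBlockPlaqs (hd : 2 ≤ P.d) {n : ℕ} (hN : 2 * P.L < P.sitesPerDir n) (U : GaugeField P 0 (SU N))
    {a₀ : ℝ} (ha₀ : 0 < a₀) (q : Pt P.d) (κ : Fin P.d)
    {S₀ : Set (Plaq P 0)} (hS₀ : boxPlaqs (fun i => (P.L : ℤ) ^ (n + 1) * q i) (fun i => (P.L : ℤ) ^ (n + 1) * (q + e κ) i + ((P.L : ℤ) ^ (n + 1) - 1)) ⊆ S₀)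
    (hU : PlaqSmallOn S₀ a₀ U)
    (hbud : 6400 * (((P.d + 2) * P.L : ℕ) : ℝ) ^ 2 * (P.L : ℝ) ^ (n + 1) * ((((P.d - 1 : ℕ) : ℝ)) * (((2 * P.L ^ (n + 1) - 1 : ℕ) : ℝ)) * a₀) ≤ 1)
    (hgd : 30 * (((P.d + 2) * P.L : ℕ) : ℝ) ^ 2 * (P.L : ℝ) ^ (n + 1) * ((((P.d - 1 : ℕ) : ℝ)) * (((2 * P.L ^ (n + 1) - 1 : ℕ) : ℝ)) * a₀) < deltaSU (Fin N))
    (hsm : ((((P.d + 2) * P.L : ℕ) : ℝ) ^ 2 / 4) * ((4 * ((((P.d - 1 : ℕ) : ℝ)) * ((2 * P.L - 1 : ℕ) : ℝ)) + 1) *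
      (240 * (((P.d + 2) * P.L : ℕ) : ℝ) * (P.L : ℝ) ^ n * ((((P.d - 1 : ℕ) : ℝ)) * (((2 * P.L ^ (n + 1) - 1 : ℕ) : ℝ)) * a₀))) < deltaSU (Fin N)) :
    Small (expMeanLogSU (n := Fin N)) (Averaging.iter (fun _ => blockAvg (expMeanLogSU (n := Fin N))) n U) ⟨castSite q, κ⟩ := by
  have hn : n + 2 ≤ P.m + P.K := succ_succ_le_of_two_mul_L_lt hN
  have hℓ : (0 : ℝ) < (((P.d + 2) * P.L : ℕ) : ℝ) := by
    have : 0 < (P.d + 2) * P.L := Nat.mul_pos (by omega) P.L_pos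
    exact_mod_cast this
  have hL0 : (0 : ℝ) < (P.L : ℝ) := by exact_mod_cast P.L_pos
  have hD1 : (0 : ℝ) < ((P.d - 1 : ℕ) : ℝ) := by exact_mod_cast (show 0 < P.d - 1 by omega)
  have h2L : (0 : ℝ) < (((2 * P.L ^ (n + 1) - 1 : ℕ) : ℝ)) := by
    have h1 : 1 ≤ P.L ^ (n + 1) := Nat.one_le_pow _ _ P.L_pos
    exact_mod_cast (show 0 < 2 * P.L ^ (n + 1) - 1 by omega)
  have hE : (0 : ℝ) < (((P.d + 2) * P.L : ℕ) : ℝ) * (P.L : ℝ) ^ n * ((((P.d - 1 : ℕ) : ℝ)) * (((2 * P.L ^ (n + 1) - 1 : ℕ) : ℝ)) * a₀) := by positivity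
  refine small_of_twoBlocks (Nat.le_of_succ_le hn) (by positivity) hN hsm _ q κ (fun p hp => ?_)
  have h := dist1_plaqHol_iter_le_of_fineTwoBlockPlaqs hn U ha₀.le q κ hS₀ hU hbud hgd p hp
  refine h.trans_lt ?_
  linarith

/-! ## §3  The fine two-block box under a centred window bond lies in the uncentred blow-up `tcube` -/

/-- **CENTRED WINDOW BOND ⇒ FINE TWO-BLOCK BOX INSIDE `□̃`**: for odd `L`, if `tloᶜ n ≤ q` and `q + e_κ ≤ thiᶜ n` (the CENTRED depth-`n` window of `[lo, hi]`, `B8Ineq130Rec`), then every `w`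
of the fine two-block box under the torus labels `(q + c_n·𝟙, q + c_n·𝟙 + e_κ)` at `i + 1` levels below, `L^{i+1}(q + c_n·𝟙) ≤ w ≤ L^{i+1}(q + c_n·𝟙 + e_κ) + L^{i+1} − 1`, lies in the
UNCENTRED depth-`(n + (i+1))` window `[L^{n+i+1}·lo, L^{n+i+1}·(hi + 𝟙) − 𝟙]` (`B8Ineq130.tlo ∕ thi`) — since `2·c_n + 1 = Lⁿ`. [cite: Balaban1987RG1, (0.1) p.251, (0.3) p.252; Balaban1985RegularSpaces, p.98 (bookkeeping)] -/
theorem twoBlockBox_subset_window (hL : Odd P.L) (lo hi : Pt P.d) (n i : ℕ) (q : Pt P.d) (κ : Fin P.d)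
    (hq : B8Ineq130Rec.tlo P.L lo n ≤ q) (hq' : q + e κ ≤ B8Ineq130Rec.thi P.L hi n) {w : Pt P.d}
    (hwlo : (fun m => (P.L : ℤ) ^ (i + 1) * ((q + fun _ => ((ctrShift P.L n : ℕ) : ℤ) : Pt P.d) m)) ≤ w)
    (hwhi : w ≤ fun m => (P.L : ℤ) ^ (i + 1) * (((q + fun _ => ((ctrShift P.L n : ℕ) : ℤ) : Pt P.d) + e κ) m) + ((P.L : ℤ) ^ (i + 1) - 1)) :
    InBox (B8Ineq130.tlo P.L lo (n + (i + 1))) (B8Ineq130.thi P.L hi (n + (i + 1))) w := by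
  intro m
  have h1 := hq m
  have h2 := hq' m
  have h3 := hwlo m
  have h4 := hwhi m
  rw [B8Ineq130Rec.tlo_apply hL] at h1
  simp only [Pi.add_apply] at h2 h3 h4
  rw [B8Ineq130Rec.thi_apply hL] at h2
  have hc : 2 * (ctrShift P.L n : ℤ) + 1 = (P.L : ℤ) ^ n := by exact_mod_cast two_mul_ctrShift_add_one hL n
  have hLi : (0 : ℤ) ≤ (P.L : ℤ) ^ (i + 1) := by positivity
  rw [B8Ineq130.tlo_apply, B8Ineq130.thi_apply, pow_add]
  constructor
  · nlinarith
  · nlinarith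

/-- **THE BOX PLAQUETTES OF THE FINE TWO-BLOCK BOX UNDER A CENTRED WINDOW BOND OF `□̃ = tcube L a M ρ k` LIE IN `plaqsOf Ω_c`** whenever `π '' □̃ ⊆ Ω_c` (depth `n = k − (i+1)`, `i < k`).
[cite: Balaban1985Variational, (144) p.300, (147) p.301; Balaban1985RegularSpaces, p.98, (1.7) p.77; Balaban1987RG1, (0.1) p.251, (0.3) p.252] -/
theorem boxPlaqs_twoBlock_subset_plaqsOf_of_collar (a : Pt P.d) (M ρ : ℕ) {k i : ℕ} (hi : i < k) {Ωc : Set (Site P 0)}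
    (hcollar : cover P '' tcube P.L a M ρ k ⊆ Ωc) (q : Pt P.d) (κ : Fin P.d)
    (hq : B8Ineq130Rec.tlo P.L (tLo a ρ) (k - (i + 1)) ≤ q) (hq' : q + e κ ≤ B8Ineq130Rec.thi P.L (tHi a M ρ) (k - (i + 1))) :
    boxPlaqs (fun m => (P.L : ℤ) ^ (i + 1) * ((q + fun _ => ((ctrShift P.L (k - (i + 1)) : ℕ) : ℤ) : Pt P.d) m))
        (fun m => (P.L : ℤ) ^ (i + 1) * (((q + fun _ => ((ctrShift P.L (k - (i + 1)) : ℕ) : ℤ) : Pt P.d) + e κ) m) + ((P.L : ℤ) ^ (i + 1) - 1)) ⊆ plaqsOf Ωc := by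
  rintro p ⟨z, hzlo, hzhi, hsrc⟩
  rw [mem_plaqsOf]
  left
  have he0 : ∀ (κ' : Fin P.d) (m : Fin P.d), (0 : ℤ) ≤ e κ' m := fun κ' m => by rw [e_apply]; split_ifs <;> norm_num
  have hzhi' : z ≤ fun m => (P.L : ℤ) ^ (i + 1) * (((q + fun _ => ((ctrShift P.L (k - (i + 1)) : ℕ) : ℤ) : Pt P.d) + e κ) m) + ((P.L : ℤ) ^ (i + 1) - 1) := by
    intro m
    have h := hzhi m
    have h1 := he0 p.μ m
    have h2 := he0 p.ν m
    simp only [Pi.add_apply] at h ⊢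
    linarith
  have hw := twoBlockBox_subset_window P.hL.1 (tLo a ρ) (tHi a M ρ) (k - (i + 1)) i q κ hq hq' hzlo hzhi'
  have hk : k - (i + 1) + (i + 1) = k := by omega
  rw [hk] at hw
  rw [hsrc]
  exact hcollar ⟨z, hw, rfl⟩

/-! ## §4  g12's `hs` from the fine letter -/

/-- `2L < sitesPerDir i` for every `i < k` as soon as `3 ≤ sitesPerDir k` (`k ≤ m + K`): `sitesPerDir i = L^{k−i}·sitesPerDir k`. The knit's no-wrap row `Mc + 11d + 6ρ ≤ sitesPerDir j` gives
`3 ≤ sitesPerDir j` at once. [cite: Balaban1987RG1, (0.1) p.251 (bookkeeping)] -/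
theorem two_mul_L_lt_sitesPerDir_of_lt {i k : ℕ} (hik : i < k) (hk : k ≤ P.m + P.K) (h3 : 3 ≤ P.sitesPerDir k) : 2 * P.L < P.sitesPerDir i := by
  have hL1 : 1 ≤ P.L := P.L_pos
  have hsplit : P.sitesPerDir i = P.L ^ (k - i) * P.sitesPerDir k := by
    rw [Params.sitesPerDir, Params.sitesPerDir, mul_left_comm, ← pow_add]
    congr 2; omega
  have hki : P.L ≤ P.L ^ (k - i) := by
    calc P.L = P.L ^ 1 := (pow_one _).symm
      _ ≤ P.L ^ (k - i) := Nat.pow_le_pow_right hL1 (by omega)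
  rw [hsplit]
  calc 2 * P.L < 3 * P.L := by omega
    _ ≤ P.sitesPerDir k * P.L ^ (k - i) := Nat.mul_le_mul h3 hki
    _ = P.L ^ (k - i) * P.sitesPerDir k := mul_comm _ _

/-- ★★★ **g12's `hs` BINDER FROM ONE FINE PLAQUETTE LETTER ON `□̃`**: for `2 ≤ d`, a cube datum `(a, M, ρ)` of level `k` with `π '' tcube L a M ρ k ⊆ Ω_c`, the fine letter `PlaqSmallOn (plaqsOf Ω_c) a₀ U`
(`0 < a₀`), `2L < sitesPerDir i` and the three two-block rows at every `i < k` (`s₂ := (d−1)(2L^{i+1}−1)·a₀`, `ℓ := (d+2)L`): every window bond `(q, q + e_κ)` of the CENTRED depth-`(k−(i+1))`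
window has `BlockAveraging.Small ℰ_N (M^i U) ⟨π_{i+1}(q + c_{k−i−1}·𝟙), κ⟩` — VERBATIM the `hs` hypothesis of ✓`…N07TowerGaugeCoverLiftWindow.localGaugeZ_coverLiftShift_eq_of_mem_tcubeZ` ∕
`…_eq_blockLift_axialGaugeAt_mul`. [cite: Balaban1987RG1, (0.3)–(0.4) pp.252–253; Balaban1985RegularSpaces, (1.14)–(1.15) p.78, Lemma 1 p.79, p.98; Balaban1985Variational, (144) p.300, (146)–(147) p.301] -/
theorem windowSmall_of_fineLetter (hd : 2 ≤ P.d) {k : ℕ} (U : GaugeField P 0 (SU N)) (a : Pt P.d) (M ρ : ℕ)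
    {a₀ : ℝ} (ha₀ : 0 < a₀) {Ωc : Set (Site P 0)} (hU : PlaqSmallOn (plaqsOf Ωc) a₀ U) (hcollar : cover P '' tcube P.L a M ρ k ⊆ Ωc)
    (hN2 : ∀ i, i < k → 2 * P.L < P.sitesPerDir i)
    (hbud₂ : ∀ i, i < k → 6400 * (((P.d + 2) * P.L : ℕ) : ℝ) ^ 2 * (P.L : ℝ) ^ (i + 1) * ((((P.d - 1 : ℕ) : ℝ)) * (((2 * P.L ^ (i + 1) - 1 : ℕ) : ℝ)) * a₀) ≤ 1)
    (hgd₂ : ∀ i, i < k → 30 * (((P.d + 2) * P.L : ℕ) : ℝ) ^ 2 * (P.L : ℝ) ^ (i + 1) * ((((P.d - 1 : ℕ) : ℝ)) * (((2 * P.L ^ (i + 1) - 1 : ℕ) : ℝ)) * a₀) < deltaSU (Fin N))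
    (hsm₂ : ∀ i, i < k → ((((P.d + 2) * P.L : ℕ) : ℝ) ^ 2 / 4) * ((4 * ((((P.d - 1 : ℕ) : ℝ)) * ((2 * P.L - 1 : ℕ) : ℝ)) + 1) *
      (240 * (((P.d + 2) * P.L : ℕ) : ℝ) * (P.L : ℝ) ^ i * ((((P.d - 1 : ℕ) : ℝ)) * (((2 * P.L ^ (i + 1) - 1 : ℕ) : ℝ)) * a₀))) < deltaSU (Fin N)) :
    ∀ i, i < k → ∀ (q : Pt P.d) (κ : Fin P.d), B8Ineq130Rec.tlo P.L (tLo a ρ) (k - (i + 1)) ≤ q → q + e κ ≤ B8Ineq130Rec.thi P.L (tHi a M ρ) (k - (i + 1)) →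
      Small (expMeanLogSU (n := Fin N)) (Averaging.iter (fun _ => blockAvg (expMeanLogSU (n := Fin N))) i U)
        ⟨coverAt P (i + 1) (q + fun _ => ((ctrShift P.L (k - (i + 1)) : ℕ) : ℤ)), κ⟩ := by
  intro i hi q κ hq hq'
  exact small_iter_of_fineTwoBlockPlaqs hd (hN2 i hi) U ha₀ (q + fun _ => ((ctrShift P.L (k - (i + 1)) : ℕ) : ℤ)) κ
    (boxPlaqs_twoBlock_subset_plaqsOf_of_collar a M ρ hi hcollar q κ hq hq') hU (hbud₂ i hi) (hgd₂ i hi) (hsm₂ i hi)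

end Summit.QuantumFields.YangMills.BalabanUVNodes.N07WindowGuardOfFineLetter

end
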